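import Summits.ValiantsHypothesis.ValiantsHypothesis.Theorems.LacunarySymmetroidMatrixDescartesCensusV19CSoundCover
import Summits.ValiantsHypothesis.ValiantsHypothesis.Theorems.LacunarySymmetroidMatrixDescartesCensusV19CBox18Part01
import Summits.ValiantsHypothesis.ValiantsHypothesis.Theorems.LacunarySymmetroidMatrixDescartesCensusV19CBox18Part02
import Summits.ValiantsHypothesis.ValiantsHypothesis.Theorems.LacunarySymmetroidMatrixDescartesCensusV19CBox18Part03
import Summits.ValiantsHypothesis.ValiantsHypothesis.Theorems.LacunarySymmetroidMatrixDescartesCensusV19CBox18Part04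
import Summits.ValiantsHypothesis.ValiantsHypothesis.Theorems.LacunarySymmetroidMatrixDescartesCensusV19CBox18Part05
import Summits.ValiantsHypothesis.ValiantsHypothesis.Theorems.LacunarySymmetroidMatrixDescartesCensusV19CBox18Part06
import Summits.ValiantsHypothesis.ValiantsHypothesis.Theorems.LacunarySymmetroidMatrixDescartesCensusV19CBox18Part07
import Summits.ValiantsHypothesis.ValiantsHypothesis.Theorems.LacunarySymmetroidMatrixDescartesCensusV19CBox18Part08
import Summits.ValiantsHypothesis.ValiantsHypothesis.Theorems.LacunarySymmetroidMatrixDescartesCensusV19CBox18Part09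
import Summits.ValiantsHypothesis.ValiantsHypothesis.Theorems.LacunarySymmetroidMatrixDescartesCensusV19CBox18Part10
import Summits.ValiantsHypothesis.ValiantsHypothesis.Theorems.LacunarySymmetroidMatrixDescartesCensusV19CBox18Part11
import Summits.ValiantsHypothesis.ValiantsHypothesis.Theorems.LacunarySymmetroidMatrixDescartesCensusV19CBox18Part12
import Summits.ValiantsHypothesis.ValiantsHypothesis.Theorems.LacunarySymmetroidMatrixDescartesCensusV19CBox18Part13
import Summits.ValiantsHypothesis.ValiantsHypothesis.Theorems.LacunarySymmetroidMatrixDescartesCensusV19CBox18Part14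
import Summits.ValiantsHypothesis.ValiantsHypothesis.Theorems.LacunarySymmetroidMatrixDescartesCensusV19CBox18Part15
import Summits.ValiantsHypothesis.ValiantsHypothesis.Theorems.LacunarySymmetroidMatrixDescartesCensusV19CBox18Part16
import Summits.ValiantsHypothesis.ValiantsHypothesis.Theorems.LacunarySymmetroidMatrixDescartesCensusV19CBox18Part17
import Summits.ValiantsHypothesis.ValiantsHypothesis.Theorems.LacunarySymmetroidMatrixDescartesCensusV19CBox18Part18
import Summits.ValiantsHypothesis.ValiantsHypothesis.Theorems.LacunarySymmetroidMatrixDescartesCensusV19CBox18Part19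
import Summits.ValiantsHypothesis.ValiantsHypothesis.Theorems.LacunarySymmetroidMatrixDescartesCensusV19CBox18Part20
import Summits.ValiantsHypothesis.ValiantsHypothesis.Theorems.LacunarySymmetroidMatrixDescartesCensusV19CBox18Cover
import Summits.ValiantsHypothesis.ValiantsHypothesis.Theorems.LacunarySymmetroidMatrixDescartesCensusSidonBox18

/-!
# `MatrixDescartes` census — CASE C of the `V = 19` layer on the box `d₅ − d₀ ≤ 18` IN THE KERNEL, BY REFLECTION: `ζ(2,6; d) ≤ 18` on every one-collision support of the box except 24 named ones; with the 2-Sidon half (`Census.doorA26_sidon_box18`) the box-18 EIGHTEEN statement minus those 24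

HONEST FRAMING.  Object-search cell `pub-symmetroid`; door-A item `DoorA26 = PosRootLawAt 2 6 19` (stmt-ValiantsHypothesis-19979; OPEN, typed, never asserted)
and its sharper support rows `PosRootLawOn 2 6 18 d`.  ASSEMBLY of this seat's Case-C reflective programme (val-sym-door-p4 g4; desk R1644 (c) / R1654 (c) /
R1666 / R1678; statement shape R1592 = TABLE theorem with NAMED EXCEPTIONS): the kernel-evaluable checker `V19C.checkSupport` (`…CensusV19CCheck`), its
semantics (`…CensusV19CModel`) and SOUNDNESS (`…CensusV19CSound{Terms,Rows,Farkas,Certs,Order,Dict,Sharp,Nineteen,Cover}`: a real symmetric `2 × 2`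
six-term pencil with `19` distinct positive det-roots on a one-collision support realises one of twelve cells — orientation × branch of `c⋆ = G_A + G_B`,
`Census.caseC_dispatch` of val-sym-door-p5 g3's …CaseCKit — and supplies a `V19C.Model` there, refuted by the cell's accepted certificate), the DATA
(`…CensusV19CBox18Part01–20`: 79 `decide +kernel` theorems replaying engine-3 g15's EXACT `casec.py` certificates — kit j236533, re-derived and validated
cell by cell by val-sym-door-p5 g3's independent code, export `HOME/val-sym-door-p5/g3/work/casec/export/` — for the 469 KEYS = one representative per mirror
pair of the 962 sorted one-collision supports `0 = d₀ < ⋯ < d₅ ≤ 18` minus the 24 exceptions, twelve cells each = 5628 cells), and the kernel COVER check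
(`…CensusV19CBox18Cover`).  RESULTS: `V19C.caseC_box18_sorted` (every sorted support of the box with exactly `20` distinct pair sums not among the 24 named
exceptions `V19C.caseC18Open` has `ζ(2,6; d) ≤ 18`), `Census.eighteen_box18_sorted_of_not_mem` (the same for ALL sorted supports of the box: `21` sums by
`doorA26_sidon_box18_sorted`, `≤ 19` sums by Descartes), and the window forms `Census.eighteen_box18_of_forall_ne` / `_caseC`.  The 24 exceptions (12 mirror
pairs) are exactly the supports both of whose mirror-pair members carry an engine-3 OPEN cell; NOTHING is claimed about them.  Nothing here bears on `ζ_sym(2,6)`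
over all supports (registers unchanged), on `DoorA26` itself, on `MatrixDescartes` (stmt-ValiantsHypothesis-18050) or on `VP ≠ VNP`.

[folklore] Certificate-checker soundness / replay; elementary.
-/

-- the D-0017 layout repeats a namespace component (single-conjunct summit); the `dupNamespace` linter flags it; name mandated.
set_option linter.dupNamespace false

namespace Summit.ValiantsHypothesis.ValiantsHypothesis.Theorems.LacunarySymmetroidMatrixDescartes.Census.V19C

open Summit.ValiantsHypothesis.ValiantsHypothesis.Theorems.MatrixDescartes.Negative (PosRootLawAt)

/-- All 469 keys of the box `d₅ ≤ 18` carry the row `ζ(2,6; d) ≤ 18` (the 79 data parts through `V19C.posRootLawOn_of_tableOK`). [folklore] -/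
theorem box18Keys_rows : ∀ d ∈ box18Keys, PosRootLawOn 2 6 18 (fun i => d.getD i 0) :=
  List.forall_mem_append.2 ⟨List.forall_mem_append.2 ⟨List.forall_mem_append.2 ⟨List.forall_mem_append.2 ⟨List.forall_mem_append.2 ⟨List.forall_mem_append.2 ⟨List.forall_mem_append.2 ⟨List.forall_mem_append.2 ⟨List.forall_mem_append.2 ⟨List.forall_mem_append.2 ⟨List.forall_mem_append.2 ⟨List.forall_mem_append.2 ⟨List.forall_mem_append.2 ⟨List.forall_mem_append.2 ⟨List.forall_mem_append.2 ⟨List.forall_mem_append.2 ⟨List.forall_mem_append.2 ⟨List.forall_mem_append.2 ⟨List.forall_mem_append.2 ⟨List.forall_mem_append.2 ⟨List.forall_mem_append.2 ⟨List.forall_mem_append.2 ⟨List.forall_mem_append.2 ⟨List.forall_mem_append.2 ⟨List.forall_mem_append.2 ⟨List.forall_mem_append.2 ⟨List.forall_mem_append.2 ⟨List.forall_mem_append.2 ⟨List.forall_mem_append.2 ⟨List.forall_mem_append.2 ⟨List.forall_mem_append.2 ⟨List.forall_mem_append.2 ⟨List.forall_mem_append.2 ⟨List.forall_mem_append.2 ⟨List.forall_mem_append.2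 ⟨List.forall_mem_append.2 ⟨List.forall_mem_append.2 ⟨List.forall_mem_append.2 ⟨List.forall_mem_append.2 ⟨List.forall_mem_append.2 ⟨List.forall_mem_append.2 ⟨List.forall_mem_append.2 ⟨List.forall_mem_append.2 ⟨List.forall_mem_append.2 ⟨List.forall_mem_append.2 ⟨List.forall_mem_append.2 ⟨List.forall_mem_append.2 ⟨List.forall_mem_append.2 ⟨List.forall_mem_append.2 ⟨List.forall_mem_append.2 ⟨List.forall_mem_append.2 ⟨List.forall_mem_append.2 ⟨List.forall_mem_append.2 ⟨List.forall_mem_append.2 ⟨List.forall_mem_append.2 ⟨List.forall_mem_append.2 ⟨List.forall_mem_append.2 ⟨List.forall_mem_append.2 ⟨List.forall_mem_append.2 ⟨List.forall_mem_append.2 ⟨List.forall_mem_append.2 ⟨List.forall_mem_append.2 ⟨List.forall_mem_append.2 ⟨List.forall_mem_append.2 ⟨List.forall_mem_append.2 ⟨List.forall_mem_append.2 ⟨List.forall_mem_append.2 ⟨List.forall_mem_append.2 ⟨List.forall_mem_append.2 ⟨List.forall_mem_append.2 ⟨List.forall_mem_append.2 ⟨List.forall_mem_append.2 ⟨List.forall_mem_append.2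 ⟨List.forall_mem_append.2 ⟨List.forall_mem_append.2 ⟨List.forall_mem_append.2 ⟨List.forall_mem_append.2 ⟨List.forall_mem_append.2 ⟨posRootLawOn_of_tableOK _ _ table18_001, posRootLawOn_of_tableOK _ _ table18_002⟩, posRootLawOn_of_tableOK _ _ table18_003⟩, posRootLawOn_of_tableOK _ _ table18_004⟩, posRootLawOn_of_tableOK _ _ table18_005⟩, posRootLawOn_of_tableOK _ _ table18_006⟩, posRootLawOn_of_tableOK _ _ table18_007⟩, posRootLawOn_of_tableOK _ _ table18_008⟩, posRootLawOn_of_tableOK _ _ table18_009⟩, posRootLawOn_of_tableOK _ _ table18_010⟩, posRootLawOn_of_tableOK _ _ table18_011⟩, posRootLawOn_of_tableOK _ _ table18_012⟩, posRootLawOn_of_tableOK _ _ table18_013⟩, posRootLawOn_of_tableOK _ _ table18_014⟩, posRootLawOn_of_tableOK _ _ table18_015⟩, posRootLawOn_of_tableOK _ _ table18_016⟩, posRootLawOn_of_tableOK _ _ table18_017⟩, posRootLawOn_of_tableOK _ _ table18_018⟩, posRootLawOn_of_tableOK _ _ table18_019⟩, posRootLawOn_of_tableOK _ _ table18_020⟩,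 posRootLawOn_of_tableOK _ _ table18_021⟩, posRootLawOn_of_tableOK _ _ table18_022⟩, posRootLawOn_of_tableOK _ _ table18_023⟩, posRootLawOn_of_tableOK _ _ table18_024⟩, posRootLawOn_of_tableOK _ _ table18_025⟩, posRootLawOn_of_tableOK _ _ table18_026⟩, posRootLawOn_of_tableOK _ _ table18_027⟩, posRootLawOn_of_tableOK _ _ table18_028⟩, posRootLawOn_of_tableOK _ _ table18_029⟩, posRootLawOn_of_tableOK _ _ table18_030⟩, posRootLawOn_of_tableOK _ _ table18_031⟩, posRootLawOn_of_tableOK _ _ table18_032⟩, posRootLawOn_of_tableOK _ _ table18_033⟩, posRootLawOn_of_tableOK _ _ table18_034⟩, posRootLawOn_of_tableOK _ _ table18_035⟩, posRootLawOn_of_tableOK _ _ table18_036⟩, posRootLawOn_of_tableOK _ _ table18_037⟩, posRootLawOn_of_tableOK _ _ table18_038⟩, posRootLawOn_of_tableOK _ _ table18_039⟩, posRootLawOn_of_tableOK _ _ table18_040⟩, posRootLawOn_of_tableOK _ _ table18_041⟩, posRootLawOn_of_tableOK _ _ table18_042⟩, posRootLawOn_of_tableOK _ _ table18_043⟩, posRootLawOn_of_tableOK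 _ _ table18_044⟩, posRootLawOn_of_tableOK _ _ table18_045⟩, posRootLawOn_of_tableOK _ _ table18_046⟩, posRootLawOn_of_tableOK _ _ table18_047⟩, posRootLawOn_of_tableOK _ _ table18_048⟩, posRootLawOn_of_tableOK _ _ table18_049⟩, posRootLawOn_of_tableOK _ _ table18_050⟩, posRootLawOn_of_tableOK _ _ table18_051⟩, posRootLawOn_of_tableOK _ _ table18_052⟩, posRootLawOn_of_tableOK _ _ table18_053⟩, posRootLawOn_of_tableOK _ _ table18_054⟩, posRootLawOn_of_tableOK _ _ table18_055⟩, posRootLawOn_of_tableOK _ _ table18_056⟩, posRootLawOn_of_tableOK _ _ table18_057⟩, posRootLawOn_of_tableOK _ _ table18_058⟩, posRootLawOn_of_tableOK _ _ table18_059⟩, posRootLawOn_of_tableOK _ _ table18_060⟩, posRootLawOn_of_tableOK _ _ table18_061⟩, posRootLawOn_of_tableOK _ _ table18_062⟩, posRootLawOn_of_tableOK _ _ table18_063⟩, posRootLawOn_of_tableOK _ _ table18_064⟩, posRootLawOn_of_tableOK _ _ table18_065⟩, posRootLawOn_of_tableOK _ _ table18_066⟩, posRootLawOn_of_tableOK _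 _ table18_067⟩, posRootLawOn_of_tableOK _ _ table18_068⟩, posRootLawOn_of_tableOK _ _ table18_069⟩, posRootLawOn_of_tableOK _ _ table18_070⟩, posRootLawOn_of_tableOK _ _ table18_071⟩, posRootLawOn_of_tableOK _ _ table18_072⟩, posRootLawOn_of_tableOK _ _ table18_073⟩, posRootLawOn_of_tableOK _ _ table18_074⟩, posRootLawOn_of_tableOK _ _ table18_075⟩, posRootLawOn_of_tableOK _ _ table18_076⟩, posRootLawOn_of_tableOK _ _ table18_077⟩, posRootLawOn_of_tableOK _ _ table18_078⟩, posRootLawOn_of_tableOK _ _ table18_079⟩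

/-- **CASE C, box 18, sorted form (kernel)**: every sorted support `0 = d₀ < ⋯ < d₅ ≤ 18` with exactly `20` distinct pair sums that is not one of the
24 named exceptions `caseC18Open` has at most `18` distinct positive det-roots for every real symmetric `2 × 2` six-term pencil on it. [folklore] -/
theorem caseC_box18_sorted (d : Fin 6 → ℕ) (hd : StrictMono d) (h0 : d 0 = 0) (h5 : d 5 ≤ 18)
    (h20 : ((Finset.univ : Finset (Fin 6 × Fin 6)).image (fun p => d p.1 + d p.2)).card = 20)
    (hexc : [d 0, d 1, d 2, d 3, d 4, d 5] ∉ caseC18Open) : PosRootLawOn 2 6 18 d :=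
  box_of_planX 0 18 plan18 caseC18Open box18Keys plan18_covers cover18 box18Keys_rows d hd h0 (Nat.zero_le _) h5 h20 hexc

end Summit.ValiantsHypothesis.ValiantsHypothesis.Theorems.LacunarySymmetroidMatrixDescartes.Census.V19C

namespace Summit.ValiantsHypothesis.ValiantsHypothesis.Theorems.LacunarySymmetroidMatrixDescartes.Census

open Summit.ValiantsHypothesis.ValiantsHypothesis.Theorems.MatrixDescartes.Negative (PosRootLawAt)

/-- **BOX 18 EIGHTEEN STATEMENT minus 24 named supports, sorted form (kernel)**: every sorted support `0 = d₀ < ⋯ < d₅ ≤ 18` not among the 24 one-collision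
exceptions `V19C.caseC18Open` satisfies `ζ(2,6; d) ≤ 18 = D(2,6) − 2` — `21` distinct pair sums by `doorA26_sidon_box18_sorted` (val-sym-door-p4 g2),
`20` by `V19C.caseC_box18_sorted` (this programme), `≤ 19` by the support's own Descartes count. [folklore] -/
theorem eighteen_box18_sorted_of_not_mem (d : Fin 6 → ℕ) (hd : StrictMono d) (h0 : d 0 = 0) (h5 : d 5 ≤ 18)
    (hexc : [d 0, d 1, d 2, d 3, d 4, d 5] ∉ V19C.caseC18Open) : PosRootLawOn 2 6 18 d := by
  by_cases h21 : 21 ≤ ((Finset.univ : Finset (Fin 6 × Fin 6)).image (fun p => d p.1 + d p.2)).card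
  · exact doorA26_sidon_box18_sorted d hd h0 h5 h21
  · by_cases h20 : ((Finset.univ : Finset (Fin 6 × Fin 6)).image (fun p => d p.1 + d p.2)).card = 20
    · exact V19C.caseC_box18_sorted d hd h0 h5 h20 hexc
    · exact doorA26_box18_of_card_pairSums_le d (by omega)

/-- **CASE C, box 18, window form**: an exponent vector in a window of width `18` with exactly `20` distinct pair sums satisfies `ζ(2,6; d) ≤ 18` unless a
re-indexed translate of it is one of the 24 exceptions (`V19C.posRootLawOn_box_of_sorted_except20`). [folklore] -/
theorem eighteen_box18_of_forall_ne_caseC (d : Fin 6 → ℕ) (hw : ∀ i j, d i ≤ d j + 18)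
    (h20 : ((Finset.univ : Finset (Fin 6 × Fin 6)).image (fun p => d p.1 + d p.2)).card = 20)
    (hex : ∀ v ∈ V19C.caseC18Open, ∀ (σ : Equiv.Perm (Fin 6)) (c : ℕ), (d ∘ σ) ≠ fun l => v.getD l.val 0 + c) :
    PosRootLawOn 2 6 18 d := by
  refine V19C.posRootLawOn_box_of_sorted_except20 18 18 (V19C.caseC18Open.map fun v l => v.getD l.val 0) ?_ d hw h20 ?_
  · intro e he h0 h5 h20e hexe
    refine V19C.caseC_box18_sorted e he h0 h5 h20e fun hmem => hexe ?_
    rw [List.mem_map]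
    exact ⟨_, hmem, by funext l; fin_cases l <;> rfl⟩
  · intro v hv σ c
    rw [List.mem_map] at hv
    obtain ⟨w, hw', rfl⟩ := hv
    exact hex w hw' σ c

/-- **BOX 18 EIGHTEEN STATEMENT minus 24 named supports, window form (kernel)**: every exponent vector `d : Fin 6 → ℕ` with entries in a window of width
`18` (`d i ≤ d j + 18`) satisfies the row `ζ(2,6; d) ≤ 18`, unless a re-indexed translate `d ∘ σ = v + c` of it is one of the 24 listed one-collision supports
`V19C.caseC18Open` (engine-3's OPEN Case-C cells; nothing claimed about them).  `≠ 20` pair sums: `doorA26_box18_of_card_pairSums_ne` (tree). [folklore] -/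
theorem eighteen_box18_of_forall_ne (d : Fin 6 → ℕ) (hw : ∀ i j, d i ≤ d j + 18)
    (hex : ∀ v ∈ V19C.caseC18Open, ∀ (σ : Equiv.Perm (Fin 6)) (c : ℕ), (d ∘ σ) ≠ fun l => v.getD l.val 0 + c) :
    PosRootLawOn 2 6 18 d := by
  by_cases h20 : ((Finset.univ : Finset (Fin 6 × Fin 6)).image (fun p => d p.1 + d p.2)).card = 20
  · exact eighteen_box18_of_forall_ne_caseC d hw h20 hex
  · exact doorA26_box18_of_card_pairSums_ne d hw h20

end Summit.ValiantsHypothesis.ValiantsHypothesis.Theorems.LacunarySymmetroidMatrixDescartes.Census
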